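import Summits.CriticalPhenomena.PercolationContinuityZ3.Theorems.SahiMasterFamilySparseEndSystems
import Summits.CriticalPhenomena.PercolationContinuityZ3.Theorems.SahiMasterFamilyLightAtoms

/-!
# The sparse end of Sahi's hierarchy, VI: `E_k(μ_p; U) = p^m · Ẽ(p)` for product measures with intensities `p·w`, and `Ẽ(0) ≥ 0`

Support file of the master-family programme (crux `NoHeavyLowerTail`, stmt-CriticalPhenomena-4575; cell `prim-masterthm`, seat P4,
unit `prim-masterthm-p4-g4`).  Seat document PROOF-SPARSE-END.md §0–1: THE LINK between Sahi's `E_k` and the combinatorial leading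
coefficient of `SahiMasterFamilySparseEnd{Partitions,All,UnionClosed,Cores,Systems}`.

SETTING.  Coordinates `ι` (finite), configurations `Finset ι`, the product weight `spw w p ω = ∏_{e∈ω} (p w_e) ∏_{e∉ω} (1 − p w_e)`
(intensities `p·w_e`; for `p w_e ∈ [0,1]` this is the product Bernoulli law), increasing events `U_i` (up-closed families of
configurations not containing `∅`, containing `univ`), `m` = the minimum size of a configuration in `⋂ U_i`.

* `sahiE_spw_eq` — the EXACT factorisation `E_{n+1}(spw w p; 1_U) = p^m · Ẽ(p)` with
  `Ẽ(p) = Σ_{γ ∈ ∏U_i} (−1)^{r(γ)+1} p^{cost γ − m} ∏_{a ∈ im γ} w^a (∏_{e∉a}(1 − p w_e)) ∏_{u < occ_a − 1}(u + 1 − spw w p a)`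
  (`cost γ = Σ_{a ∈ im γ} |a| ≥ m`), from the representative form / sign split (`SahiLightAtoms.sahiE_setInd_eq_sum_sign`);
* `sparseE_zero_eq` — `Ẽ(0) = Σ_{c ∈ ⋂U_i, |c| = m} w^c · Λ'(F^{(c)})`, the systems of cost `m` being exactly the admissible systems of
  disjoint representatives of the minimum configurations (`sum_card_eq_card_biUnion` ⇒ pairwise disjoint);
* **`sparseE_zero_nonneg`** — hence `Ẽ(0) ≥ 0` for `w ≥ 0` (`SahiSparseEnd.LambdaSys_nonneg`): THE SPARSE-END THEOREM — for every
  order and every family of increasing events, the leading coefficient of `E_k` at `p → 0` is nonnegative.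
HONEST FRAMING: the first coefficient only (e.g. the OR-triangle has `Ẽ(0) = 0`, `E₃ = p³(1−p)³`); Sahi `C_k` / Kahn Conj. 5 remain
open.  [this work]
-/

namespace Summit.CriticalPhenomena.PercolationContinuityZ3.Theorems

namespace SahiSparseEnd

open Finset SahiRepresentativeForm SahiLightAtoms
open Literature.Combinatorics.Sahi2008

variable {ι : Type*} [Fintype ι] [DecidableEq ι]

/-! ### The sparse product weight and the reduced terms -/

/-- The product weight with intensities `p·w_e`: `∏_{e∈ω} (p w_e) · ∏_{e∉ω} (1 − p w_e)`. [this work] -/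
noncomputable def spw (w : ι → ℝ) (p : ℝ) (ω : Finset ι) : ℝ := (∏ e ∈ ω, p * w e) * ∏ e ∈ univ \ ω, (1 - p * w e)

/-- `spw w p ω = p^{|ω|} · w^ω · ∏_{e∉ω}(1 − p w_e)`. [this work] -/
theorem spw_eq (w : ι → ℝ) (p : ℝ) (ω : Finset ι) :
    spw w p ω = p ^ ω.card * ((∏ e ∈ ω, w e) * ∏ e ∈ univ \ ω, (1 - p * w e)) := by
  rw [spw, prod_mul_distrib, prod_const]; ring

/-- The reduced factor of a representative `a` with multiplicity `j + 1`:
`w^a · ∏_{e∉a}(1 − p w_e) · ∏_{u<j} (u + 1 − spw w p a)`. [this work] -/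
noncomputable def redFactor (w : ι → ℝ) (p : ℝ) (a : Finset ι) (j : ℕ) : ℝ :=
  ((∏ e ∈ a, w e) * ∏ e ∈ univ \ a, (1 - p * w e)) * ∏ u ∈ range j, ((u : ℝ) + 1 - spw w p a)

/-- `ffm (spw w p a) j = p^{|a|} · redFactor w p a j`. [this work] -/
theorem ffm_spw (w : ι → ℝ) (p : ℝ) (a : Finset ι) (j : ℕ) : ffm (spw w p a) j = p ^ a.card * redFactor w p a j := by
  rw [ffm, redFactor, spw_eq]; ring

/-- The cost of a system: total size of its DISTINCT representatives. [this work] -/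
def cost {n : ℕ} (γ : Fin n → Finset ι) : ℕ := ∑ a ∈ univ.image γ, a.card

/-- The reduced term of a system. [this work] -/
noncomputable def redTerm (w : ι → ℝ) (p : ℝ) {n : ℕ} (γ : Fin n → Finset ι) : ℝ :=
  ∏ a ∈ univ.image γ, redFactor w p a (occ γ a - 1)

/-- **Factorisation of the magnitude**: `M(γ) = p^{cost γ} · redTerm`. [this work] -/
theorem absWeight_spw (w : ι → ℝ) (p : ℝ) {n : ℕ} (γ : Fin n → Finset ι) :
    absWeight (spw w p) γ = p ^ cost γ * redTerm w p γ := by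
  rw [absWeight, cost, redTerm, ← prod_pow_eq_pow_sum, ← prod_mul_distrib]
  exact prod_congr rfl fun a _ => ffm_spw w p a _

/-! ### Increasing events, the common configurations and the minimum size `m` -/

section Events

variable {n : ℕ} (U : Fin (n + 1) → Finset (Finset ι))
  (hU : ∀ i a a', a ∈ U i → a ⊆ a' → a' ∈ U i) (huniv : ∀ i, (univ : Finset ι) ∈ U i)

/-- The configurations common to all events. [this work] -/
def common (U : Fin (n + 1) → Finset (Finset ι)) : Finset (Finset ι) := univ.filter fun a => ∀ i, a ∈ U i

omit [DecidableEq ι] in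
/-- Membership in `common`. [this work] -/
theorem mem_common [DecidableEq ι] {a : Finset ι} : a ∈ common U ↔ ∀ i, a ∈ U i := by simp [common]

include huniv in
/-- `common U` is nonempty (it contains `univ`). [this work] -/
theorem common_nonempty : (common U).Nonempty := ⟨univ, (mem_common U).2 huniv⟩

/-- The minimum size `m` of a common configuration. [this work] -/
noncomputable def minSize (U : Fin (n + 1) → Finset (Finset ι)) (h : (common U).Nonempty) : ℕ :=
  ((common U).image Finset.card).min' (h.image _)

/-- Every common configuration has size `≥ m`. [this work] -/
theorem minSize_le {h : (common U).Nonempty} {a : Finset ι} (ha : a ∈ common U) : minSize U h ≤ a.card :=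
  min'_le _ _ (mem_image_of_mem _ ha)

include hU in
/-- The union of the representatives of a system lies in every event. [this work] -/
theorem biUnion_mem_common {γ : Fin (n + 1) → Finset ι} (hγ : γ ∈ Fintype.piFinset U) : univ.biUnion γ ∈ common U :=
  (mem_common U).2 fun i => hU i (γ i) _ (Fintype.mem_piFinset.1 hγ i) (subset_biUnion_of_mem γ (mem_univ i))

omit [Fintype ι] [DecidableEq ι] in
/-- `⋃_{a ∈ im γ} a = ⋃_i γ i`. [folklore] -/
theorem biUnion_image_id [DecidableEq ι] {n : ℕ} (γ : Fin n → Finset ι) : (univ.image γ).biUnion id = univ.biUnion γ := by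
  rw [image_biUnion]; rfl

include hU in
/-- **`cost γ ≥ m`** for every system of representatives. [this work] -/
theorem minSize_le_cost {h : (common U).Nonempty} {γ : Fin (n + 1) → Finset ι} (hγ : γ ∈ Fintype.piFinset U) :
    minSize U h ≤ cost γ := by
  calc minSize U h ≤ (univ.biUnion γ).card := minSize_le U (biUnion_mem_common U hU hγ)
    _ = ((univ.image γ).biUnion id).card := by rw [biUnion_image_id]
    _ ≤ ∑ a ∈ univ.image γ, (id a).card := card_biUnion_le
    _ = cost γ := rfl

/-! ### The factorisation `E = p^m · Ẽ(p)` -/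

/-- The reduced functional `Ẽ(p) = Σ_γ (−1)^{r+1} p^{cost γ − m} redTerm`. [this work] -/
noncomputable def sparseE (w : ι → ℝ) (U : Fin (n + 1) → Finset (Finset ι)) (m : ℕ) (p : ℝ) : ℝ :=
  ∑ γ ∈ Fintype.piFinset U, (-1) ^ ((univ.image γ).card + 1) * (p ^ (cost γ - m) * redTerm w p γ)

include hU in
/-- **`E_{n+1}(spw w p; 1_{U_0},…,1_{U_n}) = p^m · Ẽ(p)`** — an exact identity for every real `p`. [this work] -/
theorem sahiE_spw_eq (w : ι → ℝ) (p : ℝ) (h : (common U).Nonempty) :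
    sahiE (spw w p) (n + 1) (fun i => setInd (U i)) = p ^ minSize U h * sparseE w U (minSize U h) p := by
  rw [sahiE_setInd_eq_sum_sign, sparseE, mul_sum]
  refine sum_congr rfl fun γ hγ => ?_
  rw [absWeight_spw, ← Nat.add_sub_cancel' (minSize_le_cost U hU (h := h) hγ), pow_add, Nat.add_sub_cancel_left]
  ring

end Events

end SahiSparseEnd

end Summit.CriticalPhenomena.PercolationContinuityZ3.Theorems
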